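import Summits.ResolutionOfSingularities.ResolutionOfSingularities.Theorems.FrobeniusLadderFInjectiveMacaulayficationFedderOrigin
import Summits.ResolutionOfSingularities.ResolutionOfSingularities.Theorems.FrobeniusLadderFInjectiveMacaulayficationHypersurfaceRegular
import Summits.ResolutionOfSingularities.ResolutionOfSingularities.Theorems.FrobeniusLadderFInjectiveMacaulayficationFiClauseOfRegular
import Summits.ResolutionOfSingularities.ResolutionOfSingularities.Theorems.FrobeniusLadderFInjectiveMacaulayficationQuotLocalizationIso
import Summits.ResolutionOfSingularities.ResolutionOfSingularities.Theorems.FrobeniusLadderFInjectiveMacaulayficationDegreeZeroDescentLocal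
import Mathlib.Algebra.MvPolynomial.Rename
import Mathlib.Algebra.MvPolynomial.PDeriv
import Mathlib.Algebra.CharP.Algebra
import HarnessLib

/-!
# The `X₃`-chart of the blown-up threefold satisfies the clause along the exceptional divisor

Support file for crux stmt-ResolutionOfSingularities-15315
(`FrobeniusLadder.FInjectiveMacaulayfication`, line `Sketch`, lead seat c7, cycle 8): stub
`stub_threefoldChart3Points` of the §13 THREEFOLD CALIBRATION (dimension `3`, characteristic `2`).

The germ `f = X₀²X₁ + X₁²X₂ + X₂²X₀ + X₀X₃³ + X₁X₂X₃² ∈ k[X₀, X₁, X₂, X₃]` is Cohen–Macaulay but NOT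
F-injective at the origin in characteristic `2` (`f ∈ (Xᵢ²)`: Fedder's test fails). On the `X₃`-chart of
the blow-up of the origin its strict transform is
`g₃ = X₀²X₁ + X₁²X₂ + X₂²X₀ + X₀X₃ + X₁X₂X₃ ∈ S = k[X₀, X₁, X₂, X₃]`, and the exceptional divisor is
`E = {X₃ = 0}`. THIS FILE IS THE FEDDER FLIP: we prove (`stub_threefoldChart3Points`) that for a field
`k` of characteristic `2` and EVERY maximal ideal `Q` of `S/(g₃)` on `E` (`X̄₃ ∈ Q`) the local ring
`(S/(g₃))_Q` satisfies the per-stalk clause of the crux: every system of parameters is a weakly regular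
sequence and generates a Frobenius closed ideal (Cohen–Macaulay + F-injective, inline form, `p = 2`).

Proof. Put `P = Q ∩ S` (a prime containing `X₃` and `g₃`).
* If `X₀, X₁, X₂ ∈ P` (`clause_of_comap_eq_origin`), then `P = (X₀, X₁, X₂, X₃)` is the origin
  (`eq_span_range_X_of_mem`). Fedder's test at the origin (`Fedder.fedder_criterion_origin`,
  [Fedder1983] Prop. 1.7 / Thm. 1.12) reduces the clause for `S_P/(g₃)` to
  `g₃^(2-1) = g₃ ∉ (X₀², X₁², X₂², X₃²)`, and this holds (`g3_notMem`): `g₃` contains the SQUAREFREE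
  monomial `X₀X₃`; the substitution `X₁, X₂ ↦ 0` maps the monomial ideal `(Xᵢ²)` into itself and `g₃`
  to `X₀X₃` (`aeval_kill_g3`), which is not in `(Xᵢ²)` (`monomial_notMem_frobeniusSpan`,
  `MvPolynomial.mem_ideal_span_monomial_image`). The clause then moves along `S_P/(g₃) ≅ (S/(g₃))_Q`
  (`QuotLocalizationIso.stub_quotLocalizationIso`, `DegreeZeroDescent.inlineClause_of_ringEquiv`).
* Otherwise some `Xⱼ ∉ P`, `j ∈ {0, 1, 2}` (`clause_of_pderiv_notMem`). Jacobian certificates in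
  characteristic `2` (`pderiv_zero_g3`, `pderiv_one_g3`, `pderiv_two_g3`):
  `∂₁g₃ = X₀² + 2X₁X₂ + X₂X₃ ≡ X₀²`, `∂₂g₃ = X₁² + 2X₂X₀ + X₁X₃ ≡ X₁²`, `∂₀g₃ = 2X₀X₁ + X₂² + X₃ ≡ X₂²`
  modulo `(X₃, 2)`; so `X₀ ∉ P ⇒ ∂₁g₃ ∉ P`, `X₁ ∉ P ⇒ ∂₂g₃ ∉ P`, `X₂ ∉ P ⇒ ∂₀g₃ ∉ P` (primality), and
  `(S/(g₃))_Q` is a regular local ring by the Jacobian criterion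
  (`HypersurfaceRegular.stub_hypersurfaceRegularOfPderiv`, [Matsumura1987] Thm. 30.4) of characteristic
  `2`; regular local rings satisfy the clause (`FiClauseOfRegular.stub_fiClauseOfRegular`).

References: [Fedder1983] R. Fedder, F-purity and rational singularity, Trans. AMS 278 (1983),
Prop. 1.7 and Thm. 1.12; [Matsumura1987] H. Matsumura, Commutative Ring Theory, Thm. 30.4.
-/

-- single-problem summit: the doubled namespace component is forced
set_option linter.dupNamespace false

noncomputable section

namespace Summit.ResolutionOfSingularities.ResolutionOfSingularities.Theorems.FInjectiveMacaulayfication.ThreefoldChart3Points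

open MvPolynomial
open Summit.ResolutionOfSingularities.ResolutionOfSingularities.Theorems.FInjectiveMacaulayfication

/-! ## Polynomial identities for `g₃ = X₀²X₁ + X₁²X₂ + X₂²X₀ + X₀X₃ + X₁X₂X₃` -/

/-- **`∂g₃/∂X₀ = 2X₀X₁ + X₂² + X₃`** over any commutative ring (`MvPolynomial.pderiv_mul`, `pderiv_pow`,
`pderiv_X_self`, `pderiv_X_of_ne`). [folklore] -/
theorem pderiv_zero_g3 {A : Type*} [CommRing A] :
    pderiv 0 (X 0 ^ 2 * X 1 + X 1 ^ 2 * X 2 + X 2 ^ 2 * X 0 + X 0 * X 3 + X 1 * X 2 * X 3 :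
      MvPolynomial (Fin 4) A) = 2 * (X 0 * X 1) + X 2 ^ 2 + X 3 := by
  simp only [map_add, pderiv_mul, pderiv_pow, pderiv_X_self,
    pderiv_X_of_ne (show (1 : Fin 4) ≠ 0 by decide), pderiv_X_of_ne (show (2 : Fin 4) ≠ 0 by decide),
    pderiv_X_of_ne (show (3 : Fin 4) ≠ 0 by decide),
    mul_zero, zero_add, add_zero, mul_one, one_mul, zero_mul]
  push_cast
  ring

/-- **`∂g₃/∂X₁ = X₀² + 2X₁X₂ + X₂X₃`** over any commutative ring. [folklore] -/
theorem pderiv_one_g3 {A : Type*} [CommRing A] :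
    pderiv 1 (X 0 ^ 2 * X 1 + X 1 ^ 2 * X 2 + X 2 ^ 2 * X 0 + X 0 * X 3 + X 1 * X 2 * X 3 :
      MvPolynomial (Fin 4) A) = X 0 ^ 2 + 2 * (X 1 * X 2) + X 2 * X 3 := by
  simp only [map_add, pderiv_mul, pderiv_pow, pderiv_X_self,
    pderiv_X_of_ne (show (0 : Fin 4) ≠ 1 by decide), pderiv_X_of_ne (show (2 : Fin 4) ≠ 1 by decide),
    pderiv_X_of_ne (show (3 : Fin 4) ≠ 1 by decide),
    mul_zero, zero_add, add_zero, mul_one, one_mul, zero_mul]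
  push_cast
  ring

/-- **`∂g₃/∂X₂ = X₁² + 2X₂X₀ + X₁X₃`** over any commutative ring. [folklore] -/
theorem pderiv_two_g3 {A : Type*} [CommRing A] :
    pderiv 2 (X 0 ^ 2 * X 1 + X 1 ^ 2 * X 2 + X 2 ^ 2 * X 0 + X 0 * X 3 + X 1 * X 2 * X 3 :
      MvPolynomial (Fin 4) A) = X 1 ^ 2 + 2 * (X 2 * X 0) + X 1 * X 3 := by
  simp only [map_add, pderiv_mul, pderiv_pow, pderiv_X_self,
    pderiv_X_of_ne (show (0 : Fin 4) ≠ 2 by decide), pderiv_X_of_ne (show (1 : Fin 4) ≠ 2 by decide),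
    pderiv_X_of_ne (show (3 : Fin 4) ≠ 2 by decide),
    mul_zero, zero_add, add_zero, mul_one, zero_mul]
  push_cast
  ring

/-- **The substitution `X₁, X₂ ↦ 0` sends `g₃` to its squarefree monomial `X₀X₃`.** [folklore] -/
theorem aeval_kill_g3 {A : Type*} [CommRing A] :
    MvPolynomial.aeval (fun i : Fin 4 => (![X 0, 0, 0, X 3] : Fin 4 → MvPolynomial (Fin 4) A) i)
        (X 0 ^ 2 * X 1 + X 1 ^ 2 * X 2 + X 2 ^ 2 * X 0 + X 0 * X 3 + X 1 * X 2 * X 3 :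
          MvPolynomial (Fin 4) A) =
      X 0 ^ 1 * X 3 ^ 1 := by
  simp only [map_add, map_mul, map_pow, MvPolynomial.aeval_X]
  simp only [Matrix.cons_val_zero, Matrix.cons_val_one, Matrix.cons_val]
  ring

/-- The squarefree monomial `X₀X₃` is not in the monomial ideal `(X₀², X₁², X₂², X₃²)` (no exponent
reaches `2`; `MvPolynomial.mem_ideal_span_monomial_image`). [folklore] -/
theorem monomial_notMem_frobeniusSpan (k : Type) [Field k] :
    (X 0 ^ 1 * X 3 ^ 1 : MvPolynomial (Fin 4) k) ∉
      Ideal.span (Set.range fun i : Fin 4 => (X i : MvPolynomial (Fin 4) k) ^ 2) := by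
  classical
  have hrange : (Set.range fun i : Fin 4 => (X i : MvPolynomial (Fin 4) k) ^ 2) =
      (fun s => monomial s (1 : k)) '' Set.range (fun i : Fin 4 => Finsupp.single i 2) := by
    rw [← Set.range_comp]
    refine congrArg Set.range (funext fun i => ?_)
    simp only [Function.comp_apply, X_pow_eq_monomial]
  have hmon : (X 0 ^ 1 * X 3 ^ 1 : MvPolynomial (Fin 4) k) =
      monomial (Finsupp.single 0 1 + Finsupp.single 3 1) 1 := by
    simp only [X_pow_eq_monomial, monomial_mul, mul_one]
  rw [hrange, hmon, mem_ideal_span_monomial_image]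
  intro h
  obtain ⟨si, hsi, hle⟩ := h _ (by
    rw [support_monomial, if_neg one_ne_zero]
    exact Finset.mem_singleton_self _)
  obtain ⟨i, rfl⟩ := hsi
  have h2 := Finsupp.single_le_iff.mp hle
  fin_cases i <;> simp at h2

/-- **Fedder's test passes for `g₃` in exponent `2 - 1 = 1`**: `g₃ ∉ (X₀², X₁², X₂², X₃²) = 𝔪^[2]` for
`g₃ = X₀²X₁ + X₁²X₂ + X₂²X₀ + X₀X₃ + X₁X₂X₃` over any field: the substitution `X₁, X₂ ↦ 0` maps the
monomial ideal `(Xᵢ²)` into itself and `g₃` to `X₀X₃` (`aeval_kill_g3`), which is not in `(Xᵢ²)`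
(`monomial_notMem_frobeniusSpan`). [cite: Fedder1983, Prop. 1.7] -/
theorem g3_notMem (k : Type) [Field k] :
    (X 0 ^ 2 * X 1 + X 1 ^ 2 * X 2 + X 2 ^ 2 * X 0 + X 0 * X 3 + X 1 * X 2 * X 3 :
        MvPolynomial (Fin 4) k) ^ (2 - 1) ∉
      Ideal.span (Set.range fun i : Fin 4 => (X i : MvPolynomial (Fin 4) k) ^ 2) := by
  rw [show (2 - 1 : ℕ) = 1 from rfl, pow_one]
  intro h
  set φ : MvPolynomial (Fin 4) k →ₐ[k] MvPolynomial (Fin 4) k :=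
    MvPolynomial.aeval (fun i : Fin 4 => (![X 0, 0, 0, X 3] : Fin 4 → MvPolynomial (Fin 4) k) i) with hφ
  have hle : (Ideal.span (Set.range fun i : Fin 4 => (X i : MvPolynomial (Fin 4) k) ^ 2)).map φ ≤
      Ideal.span (Set.range fun i : Fin 4 => (X i : MvPolynomial (Fin 4) k) ^ 2) := by
    have hX : ∀ i : Fin 4, (X i : MvPolynomial (Fin 4) k) ^ 2 ∈
        Ideal.span (Set.range fun i : Fin 4 => (X i : MvPolynomial (Fin 4) k) ^ 2) :=
      fun i => Ideal.subset_span ⟨i, rfl⟩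
    rw [Ideal.map_le_iff_le_comap, Ideal.span_le]
    rintro _ ⟨i, rfl⟩
    rw [SetLike.mem_coe, Ideal.mem_comap, map_pow, hφ, MvPolynomial.aeval_X]
    fin_cases i
    · simpa [Matrix.cons_val_zero] using hX 0
    · simp [Matrix.cons_val_one]
    · simp [Matrix.cons_val]
    · simpa [Matrix.cons_val] using hX 3
  have h' := hle (Ideal.mem_map_of_mem φ h)
  rw [hφ, aeval_kill_g3] at h'
  exact monomial_notMem_frobeniusSpan k h'

/-- The form `g₃ = X₀²X₁ + X₁²X₂ + X₂²X₀ + X₀X₃ + X₁X₂X₃` lies in `(X₀, X₁, X₂, X₃)` and is non-zero (it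
takes the value `1` at `(1, 0, 0, 1)`). [folklore] -/
theorem g3_mem_and_ne_zero (k : Type) [Field k] :
    (X 0 ^ 2 * X 1 + X 1 ^ 2 * X 2 + X 2 ^ 2 * X 0 + X 0 * X 3 + X 1 * X 2 * X 3 :
        MvPolynomial (Fin 4) k) ∈ Ideal.span (Set.range (X : Fin 4 → MvPolynomial (Fin 4) k)) ∧
      (X 0 ^ 2 * X 1 + X 1 ^ 2 * X 2 + X 2 ^ 2 * X 0 + X 0 * X 3 + X 1 * X 2 * X 3 :
        MvPolynomial (Fin 4) k) ≠ 0 := by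
  have hX : ∀ i : Fin 4, (X i : MvPolynomial (Fin 4) k) ∈
      Ideal.span (Set.range (X : Fin 4 → MvPolynomial (Fin 4) k)) :=
    fun i => Ideal.subset_span ⟨i, rfl⟩
  refine ⟨?_, ?_⟩
  · exact add_mem (add_mem (add_mem (add_mem (Ideal.mul_mem_left _ _ (hX 1))
      (Ideal.mul_mem_left _ _ (hX 2))) (Ideal.mul_mem_left _ _ (hX 0))) (Ideal.mul_mem_left _ _ (hX 3)))
      (Ideal.mul_mem_left _ _ (hX 3))
  · intro h0
    have h1 := congrArg (MvPolynomial.aeval (fun i : Fin 4 => (![1, 0, 0, 1] : Fin 4 → k) i)) h0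
    simp [Matrix.cons_val_zero, Matrix.cons_val_one, Matrix.cons_val] at h1

/-- A prime `P` of `k[X₀, X₁, X₂, X₃]` containing `X₀, X₁, X₂, X₃` is the origin `(X₀, X₁, X₂, X₃)`: the
latter is a maximal ideal (`Fedder.isMaximal_span_range_X`) contained in the proper ideal `P`. [folklore] -/
theorem eq_span_range_X_of_mem (k : Type) [Field k] (P : Ideal (MvPolynomial (Fin 4) k)) [P.IsPrime]
    (h0 : (X 0 : MvPolynomial (Fin 4) k) ∈ P) (h1 : (X 1 : MvPolynomial (Fin 4) k) ∈ P)
    (h2 : (X 2 : MvPolynomial (Fin 4) k) ∈ P) (h3 : (X 3 : MvPolynomial (Fin 4) k) ∈ P) :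
    P = Ideal.span (Set.range (X : Fin 4 → MvPolynomial (Fin 4) k)) := by
  refine ((Fedder.isMaximal_span_range_X k 4).eq_of_le (Ideal.IsPrime.ne_top ‹_›) ?_).symm
  rw [Ideal.span_le]
  rintro _ ⟨i, rfl⟩
  fin_cases i
  exacts [h0, h1, h2, h3]

/-! ## The two kinds of points of the `X₃`-chart on the exceptional divisor -/

/-- **The origin of the chart (the Fedder flip).** For a field `k` of characteristic `2`,
`g₃ = X₀²X₁ + X₁²X₂ + X₂²X₀ + X₀X₃ + X₁X₂X₃`, the origin `P = (X₀, X₁, X₂, X₃)` of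
`S = k[X₀, X₁, X₂, X₃]` and a prime `Q` of `S/(g₃)` with `Q ∩ S = P`, the local ring `(S/(g₃))_Q`
satisfies the per-stalk clause (inline form, `p = 2`): Fedder's test at the origin
(`Fedder.fedder_criterion_origin` with `g3_notMem`) gives it for `S_P/(g₃)`, and it is transported along
`S_P/(g₃) ≅ (S/(g₃))_Q` (`QuotLocalizationIso.stub_quotLocalizationIso`,
`DegreeZeroDescent.inlineClause_of_ringEquiv`). [cite: Fedder1983, Prop. 1.7 and Thm. 1.12] -/
theorem clause_of_comap_eq_origin (k : Type) [Field k] [CharP k 2] (g₃ : MvPolynomial (Fin 4) k)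
    (hg : g₃ = X 0 ^ 2 * X 1 + X 1 ^ 2 * X 2 + X 2 ^ 2 * X 0 + X 0 * X 3 + X 1 * X 2 * X 3)
    (P : Ideal (MvPolynomial (Fin 4) k)) [P.IsMaximal]
    (hP : P = Ideal.span (Set.range (X : Fin 4 → MvPolynomial (Fin 4) k)))
    (Q : Ideal (MvPolynomial (Fin 4) k ⧸ Ideal.span {g₃})) [Q.IsPrime]
    (hQP : Q.comap (Ideal.Quotient.mk (Ideal.span {g₃})) = P) :
    ∀ d : ℕ, ringKrullDim (Localization.AtPrime Q) = d → ∀ s : Fin d → Localization.AtPrime Q,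
      (Ideal.span (Set.range s)).radical.IsMaximal →
        RingTheory.Sequence.IsWeaklyRegular (Localization.AtPrime Q) (List.ofFn s) ∧
        ∀ y : Localization.AtPrime Q, (∃ e : ℕ, y ^ 2 ^ e ∈ Ideal.span
          ((fun z : Localization.AtPrime Q => z ^ 2 ^ e) ''
            (Ideal.span (Set.range s) : Set (Localization.AtPrime Q)))) → y ∈ Ideal.span (Set.range s) := by
  haveI : Fact (Nat.Prime 2) := ⟨Nat.prime_two⟩
  obtain ⟨hgP, hg0⟩ : g₃ ∈ P ∧ g₃ ≠ 0 := by
    rw [hg, hP]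
    exact g3_mem_and_ne_zero k
  have hL := (Fedder.fedder_criterion_origin 2 k 4 P hP g₃ hgP hg0).mpr (by
    rw [hg]
    exact g3_notMem k)
  obtain ⟨e⟩ := QuotLocalizationIso.stub_quotLocalizationIso (MvPolynomial (Fin 4) k) g₃ P Q hQP
  exact DegreeZeroDescent.inlineClause_of_ringEquiv 2 e hL

/-- **The regular points.** For a field `k` of characteristic `2`, a polynomial `g ∈ S = k[X₀, …, X₃]`
and a maximal ideal `Q` of `S/(g)` at which some partial derivative `∂g/∂Xⱼ` does not vanish
(`∂g/∂Xⱼ ∉ Q ∩ S`), the local ring `(S/(g))_Q` satisfies the per-stalk clause (inline form, `p = 2`):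
it is a regular local ring by the Jacobian criterion (`HypersurfaceRegular.stub_hypersurfaceRegularOfPderiv`)
of characteristic `2`, and regular local rings satisfy the clause (`FiClauseOfRegular.stub_fiClauseOfRegular`).
[cite: Matsumura1987, Thm. 30.4 (ii)] -/
theorem clause_of_pderiv_notMem (k : Type) [Field k] [CharP k 2] (g : MvPolynomial (Fin 4) k)
    (Q : Ideal (MvPolynomial (Fin 4) k ⧸ Ideal.span {g})) [Q.IsMaximal] (j : Fin 4)
    (hd : pderiv j g ∉ Q.comap (Ideal.Quotient.mk (Ideal.span {g}))) :
    ∀ d : ℕ, ringKrullDim (Localization.AtPrime Q) = d → ∀ s : Fin d → Localization.AtPrime Q,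
      (Ideal.span (Set.range s)).radical.IsMaximal →
        RingTheory.Sequence.IsWeaklyRegular (Localization.AtPrime Q) (List.ofFn s) ∧
        ∀ y : Localization.AtPrime Q, (∃ e : ℕ, y ^ 2 ^ e ∈ Ideal.span
          ((fun z : Localization.AtPrime Q => z ^ 2 ^ e) ''
            (Ideal.span (Set.range s) : Set (Localization.AtPrime Q)))) → y ∈ Ideal.span (Set.range s) := by
  haveI : Fact (Nat.Prime 2) := ⟨Nat.prime_two⟩
  haveI : IsRegularLocalRing (Localization.AtPrime Q) :=
    HypersurfaceRegular.stub_hypersurfaceRegularOfPderiv k 4 g j Q hd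
  -- characteristic `2` passes to `S/(g)` (a non-trivial `k`-algebra) and to its localization
  haveI : Nontrivial (MvPolynomial (Fin 4) k ⧸ Ideal.span {g}) :=
    nontrivial_of_ne (1 : MvPolynomial (Fin 4) k ⧸ Ideal.span {g}) 0 fun h10 =>
      Ideal.IsMaximal.ne_top ‹_› ((Ideal.eq_top_iff_one Q).mpr (by rw [h10]; exact Q.zero_mem))
  haveI : CharP (MvPolynomial (Fin 4) k ⧸ Ideal.span {g}) 2 :=
    charP_of_injective_algebraMap
      (algebraMap k (MvPolynomial (Fin 4) k ⧸ Ideal.span {g})).injective 2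
  haveI : CharP (Localization.AtPrime Q) 2 := DegreeZeroDescent.charP_localization_atPrime 2 Q
  have key := (FiClauseOfRegular.stub_fiClauseOfRegular 2 (Localization.AtPrime Q)).2
  exact key

/-! ## Registered form -/

/-- **THREEFOLD CALIBRATION, `X₃`-chart — the Fedder flip** (stub `stub_threefoldChart3Points` of line
`Sketch`): for a field `k` of characteristic `2` and
`g₃ = X₀²X₁ + X₁²X₂ + X₂²X₀ + X₀X₃ + X₁X₂X₃ ∈ S = k[X₀, X₁, X₂, X₃]` (the strict transform of
`X₀²X₁ + X₁²X₂ + X₂²X₀ + X₀X₃³ + X₁X₂X₃²` on the `X₃`-chart of the blow-up of the origin), the local ring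
of the hypersurface `S/(g₃)` at every maximal ideal `Q` on the exceptional divisor (`X̄₃ ∈ Q`) satisfies
the per-stalk clause of `FrobeniusLadder.FInjectiveMacaulayfication`: every system of parameters is
weakly regular and generates a Frobenius closed ideal. Cases on `P = Q ∩ S`: `X₀, X₁, X₂ ∈ P` forces
`P = (X₀, X₁, X₂, X₃)`, certified by Fedder's test (`clause_of_comap_eq_origin`: `g₃` has the squarefree
monomial `X₀X₃`); otherwise `P` is a regular point by the Jacobian certificates
`∂₁g₃ ≡ X₀²`, `∂₂g₃ ≡ X₁²`, `∂₀g₃ ≡ X₂²` modulo `(X₃, 2)` (`clause_of_pderiv_notMem`).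
[cite: Fedder1983, Prop. 1.7 and Thm. 1.12] -/
theorem stub_threefoldChart3Points : ∀ (k : Type) [Field k] [CharP k 2] (g₃ : MvPolynomial (Fin 4) k),
    g₃ = MvPolynomial.X 0 ^ 2 * MvPolynomial.X 1 + MvPolynomial.X 1 ^ 2 * MvPolynomial.X 2 + MvPolynomial.X 2 ^ 2 * MvPolynomial.X 0 + MvPolynomial.X 0 * MvPolynomial.X 3 + MvPolynomial.X 1 * MvPolynomial.X 2 * MvPolynomial.X 3 →
    ∀ (Q : Ideal (MvPolynomial (Fin 4) k ⧸ Ideal.span {g₃})) [Q.IsMaximal],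
      Ideal.Quotient.mk (Ideal.span {g₃}) (MvPolynomial.X 3) ∈ Q →
      ∀ d : ℕ, ringKrullDim (Localization.AtPrime Q) = d → ∀ s : Fin d → Localization.AtPrime Q,
        (Ideal.span (Set.range s)).radical.IsMaximal →
          RingTheory.Sequence.IsWeaklyRegular (Localization.AtPrime Q) (List.ofFn s) ∧
          ∀ y : Localization.AtPrime Q, (∃ e : ℕ, y ^ 2 ^ e ∈ Ideal.span
            ((fun z : Localization.AtPrime Q => z ^ 2 ^ e) ''
              (Ideal.span (Set.range s) : Set (Localization.AtPrime Q)))) → y ∈ Ideal.span (Set.range s) := by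
  intro k _ _ g₃ hg Q _ hX3
  -- notation: `P = Q ∩ S`
  set P : Ideal (MvPolynomial (Fin 4) k) := Q.comap (Ideal.Quotient.mk (Ideal.span {g₃}))
  have hX3' : (X 3 : MvPolynomial (Fin 4) k) ∈ P := hX3
  -- `2 = 0` in `S`
  have h2 : (2 : MvPolynomial (Fin 4) k) = 0 := by
    rw [show (2 : MvPolynomial (Fin 4) k) = C (2 : k) from (map_ofNat C 2).symm,
      CharP.ofNat_eq_zero k 2, map_zero]
  by_cases hX0 : (X 0 : MvPolynomial (Fin 4) k) ∈ P
  · by_cases hX1 : (X 1 : MvPolynomial (Fin 4) k) ∈ P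
    · by_cases hX2 : (X 2 : MvPolynomial (Fin 4) k) ∈ P
      · -- the origin of the chart: Fedder's test
        have hPeq := eq_span_range_X_of_mem k P hX0 hX1 hX2 hX3'
        haveI := Fedder.isMaximal_span_range_X k 4
        exact clause_of_comap_eq_origin k g₃ hg (Ideal.span (Set.range X)) rfl Q hPeq
      · -- `X₂ ∉ P`: `∂₀g₃ = 2X₀X₁ + X₂² + X₃ ∉ P`
        refine clause_of_pderiv_notMem k g₃ Q 0 ?_
        intro hmem
        have hpd : pderiv 0 g₃ = X 2 ^ 2 + X 3 := by
          rw [hg, pderiv_zero_g3, h2, zero_mul, zero_add]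
        have hmem' : (X 2 ^ 2 + X 3 : MvPolynomial (Fin 4) k) ∈ P := by rwa [hpd] at hmem
        have hX2sq : (X 2 : MvPolynomial (Fin 4) k) ^ 2 ∈ P := by
          have h' := sub_mem hmem' hX3'
          rwa [add_sub_cancel_right] at h'
        exact hX2 (Ideal.IsPrime.mem_of_pow_mem inferInstance 2 hX2sq)
    · -- `X₁ ∉ P`: `∂₂g₃ = X₁² + 2X₂X₀ + X₁X₃ ∉ P`
      refine clause_of_pderiv_notMem k g₃ Q 2 ?_
      intro hmem
      have hpd : pderiv 2 g₃ = X 1 ^ 2 + X 1 * X 3 := by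
        rw [hg, pderiv_two_g3, h2, zero_mul, add_zero]
      have hmem' : (X 1 ^ 2 + X 1 * X 3 : MvPolynomial (Fin 4) k) ∈ P := by rwa [hpd] at hmem
      have hX1sq : (X 1 : MvPolynomial (Fin 4) k) ^ 2 ∈ P := by
        have h' := sub_mem hmem' (Ideal.mul_mem_left P (X 1) hX3')
        rwa [add_sub_cancel_right] at h'
      exact hX1 (Ideal.IsPrime.mem_of_pow_mem inferInstance 2 hX1sq)
  · -- `X₀ ∉ P`: `∂₁g₃ = X₀² + 2X₁X₂ + X₂X₃ ∉ P`
    refine clause_of_pderiv_notMem k g₃ Q 1 ?_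
    intro hmem
    have hpd : pderiv 1 g₃ = X 0 ^ 2 + X 2 * X 3 := by
      rw [hg, pderiv_one_g3, h2, zero_mul, add_zero]
    have hmem' : (X 0 ^ 2 + X 2 * X 3 : MvPolynomial (Fin 4) k) ∈ P := by rwa [hpd] at hmem
    have hX0sq : (X 0 : MvPolynomial (Fin 4) k) ^ 2 ∈ P := by
      have h' := sub_mem hmem' (Ideal.mul_mem_left P (X 2) hX3')
      rwa [add_sub_cancel_right] at h'
    exact hX0 (Ideal.IsPrime.mem_of_pow_mem inferInstance 2 hX0sq)

end Summit.ResolutionOfSingularities.ResolutionOfSingularities.Theorems.FInjectiveMacaulayfication.ThreefoldChart3Points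

end
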